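import Mathlib
import HarnessLib
import Summits.HubbardSuperconductivity.HubbardSuperconductivity.Theorems.KLProgrammeFourLegCommonTimeL1
import Summits.HubbardSuperconductivity.HubbardSuperconductivity.Theorems.KLProgrammeCyclicAbelMeanBound

/-!
# Route `KLProgramme` — ENGINE (stmt-HubbardSuperconductivity-20437 `KLRegimeEngineV17F2`): the assembled abstract bound
# `Θ ≤ ∏ᵢ Aᵢ ≤ ∏ᵢ [(2J+1)/N·‖gᵢ‖₁ + N/(4(J+1))·‖Δ²gᵢ‖₁]` for the modularly conserving four-leg `ZMod N` sum (one theorem to cite)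

Cell `gate-hubbard-kl`, seat p1b g23 (registrant lineage), def-free helper `--supports stmt-HubbardSuperconductivity-20437`;
assembles ✓ `KLProgrammeFourLegCommonTimeL1` (`klct_fourLeg_l1_le`) with ✓ `KLProgrammeCyclicAbelMeanBound` (`klct_mean_norm_dft_le`):
* `klct_fourLeg_theta_le_prod_mean` — the NORMALISED form `N⁻³ Σ_{t₁t₂t₃} ‖S(t)‖ ≤ ∏ᵢ (N⁻¹ Σ_j |ǧᵢ(j)|)` (`Θ ≤ A₁A₂A₃A₄`);
* `klct_fourLeg_theta_le` — for every `J : ℕ`, `N⁻³ Σ_t ‖S(t)‖ ≤ ∏ᵢ Bᵢ`, `Bᵢ = (2J+1)/N·Σ_n|gᵢ n| + N/(4(J+1))·Σ_n|gᵢ n - 2gᵢ(n-1) + gᵢ(n-2)|`.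
For the k3c2 lineage's cut vertex (`gᵢ = ` the UV cut-off read on the Matsubara lattice modulo `N = 2M`, width `w ≍ β·klE0`) the choice
`J ≍ N/w` makes every `Bᵢ` an absolute constant — «`Θ^cut ≤ A⁴ ≲ const`, β- and M-free» (HOME/hubbard-kl-k3c2-p2/g34/CUT-CURRENCY-DIGITS.md
rev 2) modulo the model bookkeeping listed in the companions.  Pure algebra; no definition, no model estimate; nothing here asserts any
registered row, K3, U₀, the window, a margin or superconductivity in the Hubbard model.
References: BGM 2006 §2.3 (2.17) [cite: BenfattoGiulianiMastropietro2006].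
-/

noncomputable section

namespace Summit.HubbardSuperconductivity.HubbardSuperconductivity.Theorems.KLRegimeSplit

set_option linter.dupNamespace false -- summit = problem name (single-conjunct summit), D-0017

open Finset

variable {N : ℕ} [NeZero N]

/-- **`Θ ≤ A₁A₂A₃A₄` (normalised form).** `N⁻³ Σ_{t₁t₂t₃} ‖S(t)‖ ≤ ∏ᵢ (N⁻¹ Σ_j |ǧᵢ(j)|)` for the modularly conserving four-leg sum
`S` of `klct_fourLeg_sum_eq_commonTime`. [cite: BenfattoGiulianiMastropietro2006, §2.3 (2.17)] -/
theorem klct_fourLeg_theta_le_prod_mean (g₁ g₂ g₃ g₄ : ZMod N → ℂ) :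
    ((N : ℝ) ^ 3)⁻¹ * ∑ t₁ : ZMod N, ∑ t₂ : ZMod N, ∑ t₃ : ZMod N,
        ‖∑ n₁ : ZMod N, ∑ n₂ : ZMod N, ∑ n₃ : ZMod N,
            g₁ n₁ * g₂ n₂ * g₃ n₃ * g₄ (n₁ - n₂ + n₃) *
              (ZMod.stdAddChar (n₁ * t₁) * ZMod.stdAddChar (n₂ * t₂) * ZMod.stdAddChar (n₃ * t₃))‖ ≤
      ((N : ℝ)⁻¹ * ∑ s, ‖ZMod.dft g₁ s‖) * ((N : ℝ)⁻¹ * ∑ s, ‖ZMod.dft g₂ s‖) *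
        ((N : ℝ)⁻¹ * ∑ s, ‖ZMod.dft g₃ s‖) * ((N : ℝ)⁻¹ * ∑ s, ‖ZMod.dft g₄ s‖) := by
  have hN : (0 : ℝ) < N := Nat.cast_pos.mpr (NeZero.pos N)
  have h := mul_le_mul_of_nonneg_left (klct_fourLeg_l1_le g₁ g₂ g₃ g₄) (inv_nonneg.mpr (pow_pos hN 3).le)
  refine h.trans (le_of_eq ?_)
  field_simp

/-- **THE ASSEMBLED BOUND.** For every `J : ℕ`:
`N⁻³ Σ_{t₁t₂t₃} ‖S(t)‖ ≤ ∏ᵢ [(2J+1)/N · Σ_n |gᵢ n| + N/(4(J+1)) · Σ_n |gᵢ n - 2 gᵢ(n-1) + gᵢ(n-2)|]`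
(`Θ ≤ ∏ Aᵢ` and `Aᵢ ≤ Bᵢ` by `klct_mean_norm_dft_le`). [cite: BenfattoGiulianiMastropietro2006, §2.3 (2.17)] -/
theorem klct_fourLeg_theta_le (g₁ g₂ g₃ g₄ : ZMod N → ℂ) (J : ℕ) :
    ((N : ℝ) ^ 3)⁻¹ * ∑ t₁ : ZMod N, ∑ t₂ : ZMod N, ∑ t₃ : ZMod N,
        ‖∑ n₁ : ZMod N, ∑ n₂ : ZMod N, ∑ n₃ : ZMod N,
            g₁ n₁ * g₂ n₂ * g₃ n₃ * g₄ (n₁ - n₂ + n₃) *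
              (ZMod.stdAddChar (n₁ * t₁) * ZMod.stdAddChar (n₂ * t₂) * ZMod.stdAddChar (n₃ * t₃))‖ ≤
      ((2 * J + 1) / N * (∑ n : ZMod N, ‖g₁ n‖) +
          (N : ℝ) / (4 * (J + 1)) * ∑ n : ZMod N, ‖g₁ n - 2 * g₁ (n - 1) + g₁ (n - 2)‖) *
        ((2 * J + 1) / N * (∑ n : ZMod N, ‖g₂ n‖) +
          (N : ℝ) / (4 * (J + 1)) * ∑ n : ZMod N, ‖g₂ n - 2 * g₂ (n - 1) + g₂ (n - 2)‖) *
        ((2 * J + 1) / N * (∑ n : ZMod N, ‖g₃ n‖) +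
          (N : ℝ) / (4 * (J + 1)) * ∑ n : ZMod N, ‖g₃ n - 2 * g₃ (n - 1) + g₃ (n - 2)‖) *
        ((2 * J + 1) / N * (∑ n : ZMod N, ‖g₄ n‖) +
          (N : ℝ) / (4 * (J + 1)) * ∑ n : ZMod N, ‖g₄ n - 2 * g₄ (n - 1) + g₄ (n - 2)‖) := by
  have hA : ∀ g : ZMod N → ℂ, 0 ≤ (N : ℝ)⁻¹ * ∑ s, ‖ZMod.dft g s‖ := fun g =>
    mul_nonneg (inv_nonneg.mpr (Nat.cast_nonneg N)) (Finset.sum_nonneg fun s _ => norm_nonneg _)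
  have hB := fun g : ZMod N → ℂ => klct_mean_norm_dft_le g J
  have hB0 : ∀ g : ZMod N → ℂ, 0 ≤ (2 * J + 1) / N * (∑ n : ZMod N, ‖g n‖) +
      (N : ℝ) / (4 * (J + 1)) * ∑ n : ZMod N, ‖g n - 2 * g (n - 1) + g (n - 2)‖ :=
    fun g => (hA g).trans (hB g)
  refine (klct_fourLeg_theta_le_prod_mean g₁ g₂ g₃ g₄).trans ?_
  refine mul_le_mul (mul_le_mul (mul_le_mul (hB g₁) (hB g₂) (hA g₂) (hB0 g₁)) (hB g₃) (hA g₃)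
    (mul_nonneg (hB0 g₁) (hB0 g₂))) (hB g₄) (hA g₄) ?_
  exact mul_nonneg (mul_nonneg (hB0 g₁) (hB0 g₂)) (hB0 g₃)

end Summit.HubbardSuperconductivity.HubbardSuperconductivity.Theorems.KLRegimeSplit

end
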